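import Summits.AtomisticToContinuum.FouriersLaw.Theses.HoelderEscapeProfile
import Summits.AtomisticToContinuum.FouriersLaw.Theorems.HoelderEscapeProfileCornerNoDipSeam
import Summits.AtomisticToContinuum.FouriersLaw.Theorems.HoelderEscapeProfileCornerNoDipProfileSupBound
import Summits.AtomisticToContinuum.FouriersLaw.Theorems.HoelderEscapeProfileCornerNoDipProfileRepresentation

/-!
# Split glue of crux `CornerNoDip` (stmt-AtomisticToContinuum-16009, route `HoelderEscapeProfile`) — line `heatprofile`

The kernel-checked COMPOSITION of line `heatprofile` (Cruxes/CornerNoDip/Lines/heatprofile.lean), landed so that a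
planner can promote the line's one remaining (dynamical, conjecture-grade) stub to a route item with a landed glue
(`ledger route edit … --split CornerNoDip --into … --glue …`):

* `cornerNoDip_of_negativeHeatingMomentVanishes` — ONE child: "no cold halo at any range", the `ν`-weighted second
  moment of the NEGATIVE PART of the Abel heating profile `S̄_ν(x) = ν∫₀^∞e^{-νt}Cov_μ(h_0, h_x∘φ_t)dt` vanishes,
  `ν Σ_x x²·max(−S̄_ν(x),0) → 0` (`k`-free, window-free; the registered stub `stub_negativeHeatingMomentVanishes`
  of the line, verbatim) `→ CornerNoDip`;
* `cornerNoDip_of_meso_of_far` — TWO children (the line's stubs of cycles 1–2): near-positivity of the Abel heating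
  profile on the diffusive window `ν^{-θ} < |x| ≤ L/√ν` (`θ < 1/3`) and no negative heating mass beyond `L/√ν`
  `→ CornerNoDip`.

Both hypotheses are conjecture-grade statements about the deterministic quartic pinned chain (near-positivity of
the energy linear response in Abel mean; exact at the harmonic member by Isserlis, hydrodynamically the heat kernel)
and are TAKEN AS HYPOTHESES: these theorems are glue, they close nothing. Inside, the landed stubs
`stub_profileRepresentation` (p161414: excess conservation law + Helfand–Abel + summabilities, from the route's
`FibreCalculus`) and `stub_profileSupBound` (p159323: kinematic sup bound) are discharged, and the analytic seam
`corner_noDip_of_profile` (HoelderEscapeProfileCornerNoDipSeam.lean: lattice Fejér domination) does the estimate;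
`ranges_of_negMoment` turns the `k`-free statement into the seam's window/far hypotheses (windows of a
non-negative summable family). Helper file `--supports stmt-AtomisticToContinuum-16009` (lead c2, cycle 3).
-/

noncomputable section

open Filter Topology Set MeasureTheory Finset

namespace Summit.AtomisticToContinuum.FouriersLaw.Theorems.CornerNoDip.HeatProfile

open Literature.MathematicalPhysics.KineticTheory.HeatConduction

/-- Summability of `x ↦ x²·max(−f x, 0)` from the weighted summability `Σ (1+x²)|f x| < ∞`. [folklore] -/
theorem summable_sq_mul_negPart {f : ℤ → ℝ} (h : Summable fun x : ℤ => (1 + (x : ℝ) ^ 2) * |f x|) :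
    Summable fun x : ℤ => (x : ℝ) ^ 2 * max (-(f x)) 0 := by
  refine Summable.of_norm_bounded h (fun x => ?_)
  rw [Real.norm_eq_abs, abs_of_nonneg (mul_nonneg (sq_nonneg _) (le_max_right _ _))]
  have h1 : max (-(f x)) 0 ≤ |f x| := max_le (neg_le_abs _) (abs_nonneg _)
  have h2 : (x : ℝ) ^ 2 ≤ 1 + (x : ℝ) ^ 2 := by linarith
  exact mul_le_mul h2 h1 (le_max_right _ _) (by positivity)

/-- A window of a non-negative summable family sums to at most the whole family. [folklore] -/
theorem tsum_window_le {f : ℤ → ℝ} (hf0 : ∀ x, 0 ≤ f x) (hs : Summable f) (p : ℤ → Prop)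
    [DecidablePred p] : ∑' x : ℤ, (if p x then f x else 0) ≤ ∑' x : ℤ, f x := by
  have hle : ∀ x, (if p x then f x else 0) ≤ f x := fun x => by
    split_ifs <;> [exact le_rfl; exact hf0 x]
  have h0 : ∀ x, 0 ≤ (if p x then f x else 0) := fun x => by
    split_ifs <;> [exact hf0 x; exact le_rfl]
  exact Summable.tsum_le_tsum hle (Summable.of_nonneg_of_le h0 hle hs) hs

/-- **The k-free negative-moment statement gives the window and far hypotheses of the seam.** If
`ν·Σ_x x²(Sb ν x)⁻ → 0`, then (for any exponent, here `θ = 1/4`, and any cut-off, here `L = 1`) the window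
hypothesis `h3` and the far hypothesis `h4` of `corner_noDip_of_profile` hold — a window of a non-negative
family sums to at most the whole family. [folklore] -/
theorem ranges_of_negMoment (Sb : ℝ → ℤ → ℝ)
    (h1 : ∀ ν : ℝ, 0 < ν → Summable (fun x : ℤ => (1 + (x : ℝ) ^ 2) * |Sb ν x|))
    (h : ∀ ε : ℝ, 0 < ε → ∃ ν₀ : ℝ, 0 < ν₀ ∧ ∀ ν : ℝ, 0 < ν → ν ≤ ν₀ →
      ν * (∑' x : ℤ, (x : ℝ) ^ 2 * max (-(Sb ν x)) 0) ≤ ε) :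
    (∃ θ : ℝ, 0 < θ ∧ θ < 1 / 3 ∧ ∀ L : ℝ, 0 < L → ∀ ε : ℝ, 0 < ε → ∃ ν₀ : ℝ, 0 < ν₀ ∧
      ∀ ν : ℝ, 0 < ν → ν ≤ ν₀ →
        ν * (∑' x : ℤ, (if ν ^ (-θ) < |(x : ℝ)| ∧ |(x : ℝ)| * Real.sqrt ν ≤ L
          then (x : ℝ) ^ 2 * max (-(Sb ν x)) 0 else 0)) ≤ ε) ∧
    (∀ ε : ℝ, 0 < ε → ∃ L : ℝ, 0 < L ∧ ∃ ν₀ : ℝ, 0 < ν₀ ∧ ∀ ν : ℝ, 0 < ν → ν ≤ ν₀ →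
      ν * (∑' x : ℤ, (if L < |(x : ℝ)| * Real.sqrt ν then (x : ℝ) ^ 2 * max (-(Sb ν x)) 0 else 0))
        ≤ ε) := by
  have key : ∀ (ν : ℝ), 0 < ν → ∀ (p : ℤ → Prop) [DecidablePred p],
      ν * (∑' x : ℤ, (if p x then (x : ℝ) ^ 2 * max (-(Sb ν x)) 0 else 0)) ≤
        ν * (∑' x : ℤ, (x : ℝ) ^ 2 * max (-(Sb ν x)) 0) := by
    intro ν hν p _
    exact mul_le_mul_of_nonneg_left
      (tsum_window_le (fun x => mul_nonneg (sq_nonneg _) (le_max_right _ _))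
        (summable_sq_mul_negPart (h1 ν hν)) p) hν.le
  refine ⟨⟨1 / 4, by norm_num, by norm_num, fun L _ ε hε => ?_⟩, fun ε hε => ⟨1, one_pos, ?_⟩⟩
  · obtain ⟨ν₀, hν₀, hb⟩ := h ε hε
    exact ⟨ν₀, hν₀, fun ν hν hle =>
      (key ν hν (fun x => ν ^ (-(1 / 4 : ℝ)) < |(x : ℝ)| ∧ |(x : ℝ)| * Real.sqrt ν ≤ L)).trans
        (hb ν hν hle)⟩
  · obtain ⟨ν₀, hν₀, hb⟩ := h ε hε
    exact ⟨ν₀, hν₀, fun ν hν hle =>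
      (key ν hν (fun x => (1 : ℝ) < |(x : ℝ)| * Real.sqrt ν)).trans (hb ν hν hle)⟩


/-- **Corner estimate from the k-free negative-moment statement (the seam of the registered composition).**
Same representation hypotheses `h1`, `h1s` and sup bound `h2` as `corner_noDip_of_profile`; the window and far
hypotheses are replaced by the single `ν·Σ_x x²(Sb ν x)⁻ → 0` (`h`). Via `ranges_of_negMoment` and
`corner_noDip_of_profile`. [folklore] -/
theorem corner_noDip_of_profile_of_negMoment (Sb : ℝ → ℤ → ℝ) (S0 : ℤ → ℝ) (Ghν : ℝ → ℝ → ℝ) {a ε : ℝ}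
    (ha : 0 < a) (hε : 0 < ε)
    (h1 : ∀ ν : ℝ, 0 < ν → Summable (fun x : ℤ => (1 + (x : ℝ) ^ 2) * |Sb ν x|) ∧
      (∀ k : ℝ, (2 - 2 * Real.cos k) * Ghν ν k =
        ν * ∑' x : ℤ, (1 - Real.cos (k * (x : ℝ))) * (Sb ν x - S0 x)) ∧
      Ghν ν 0 = ν / 2 * ∑' x : ℤ, (x : ℝ) ^ 2 * (Sb ν x - S0 x))
    (h1s : Summable (fun x : ℤ => (1 + (x : ℝ) ^ 2) * |S0 x|))
    (h2 : ∃ M : ℝ, ∀ ν : ℝ, 0 < ν → ∀ x : ℤ, |Sb ν x| ≤ M)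
    (h : ∀ ε : ℝ, 0 < ε → ∃ ν₀ : ℝ, 0 < ν₀ ∧ ∀ ν : ℝ, 0 < ν → ν ≤ ν₀ →
      ν * (∑' x : ℤ, (x : ℝ) ^ 2 * max (-(Sb ν x)) 0) ≤ ε) :
    ∃ ν₀ : ℝ, 0 < ν₀ ∧ ∀ ν : ℝ, 0 < ν → ν ≤ ν₀ → ∀ k : ℝ, |k| ≤ a * Real.sqrt ν →
      Ghν ν k ≤ Ghν ν 0 + ε := by
  obtain ⟨h3, h4⟩ := ranges_of_negMoment Sb (fun ν hν => (h1 ν hν).1) h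
  exact corner_noDip_of_profile Sb S0 Ghν a ε ha hε h1 h1s h2 h3 h4

/-- **GLUE (one child): `NegativeHeatingMomentVanishes → CornerNoDip`.** In the crux frame (`ω₂, lam, β > 0`,
`T > 0`, `μ` a shift- and momentum-reversal-invariant DLR state of `pinnedChain ω₂ lam β γ`, `D` a `μ`-preserving
shift-covariant `InfiniteChainDynamics`, energy objects `h`, `S`, `Sb` bound by their defining equations): if for
every `ε > 0`, eventually in `ν`, `ν · Σ_x x²·max(−S̄_ν(x), 0) ≤ ε` (the registered stub
`stub_negativeHeatingMomentVanishes` of line `heatprofile`, verbatim), then `CornerNoDip`. The landed stubs 1–2 are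
discharged inside; the estimate is `corner_noDip_of_profile_of_negMoment`. Glue only: closes nothing. [folklore] -/
theorem cornerNoDip_of_negativeHeatingMomentVanishes :
    (∀ ω₂ lam β γ : ℝ, 0 < ω₂ → 0 < lam → 0 < β → ∀ T : ℝ, 0 < T →
      ∀ μ : Measure ChainConfig, (pinnedChain ω₂ lam β γ).IsChainGibbsMeasure T μ → IsShiftInvariant μ →
      μ.map (fun σ : ChainConfig => fun x : ℤ => ((σ x).1, -(σ x).2)) = μ →
      ∀ D : InfiniteChainDynamics (pinnedChain ω₂ lam β γ), D.PreservesMeasure μ →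
      (∀ t : ℝ, ∀ᵐ σ ∂μ, D.flow t (shift σ) = shift (D.flow t σ)) →
      ∀ h : ChainConfig → ℤ → ℝ, h = (fun (σ : ChainConfig) (x : ℤ) =>
      (σ x).2 ^ 2 / 2 + (pinnedChain ω₂ lam β γ).U (σ x).1 +
      ((pinnedChain ω₂ lam β γ).V ((σ (x + 1)).1 - (σ x).1) +
      (pinnedChain ω₂ lam β γ).V ((σ x).1 - (σ (x - 1)).1)) / 2) →
      ∀ S : ℤ → ℝ → ℝ, S = (fun (x : ℤ) (t : ℝ) =>
      ∫ σ, (h σ 0 - ∫ σ', h σ' 0 ∂μ) * (h (D.flow t σ) x - ∫ σ', h σ' 0 ∂μ) ∂μ) →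
      ∀ Sb : ℝ → ℤ → ℝ, Sb = (fun (ν : ℝ) (x : ℤ) =>
      ν * ∫ t in Set.Ioi (0:ℝ), Real.exp (-(ν * t)) * S x t) →
      ∀ ε : ℝ, 0 < ε → ∃ ν₀ : ℝ, 0 < ν₀ ∧ ∀ ν : ℝ, 0 < ν → ν ≤ ν₀ →
      ν * (∑' x : ℤ, (x : ℝ) ^ 2 * max (-(Sb ν x)) 0) ≤ ε) →
    Summit.AtomisticToContinuum.FouriersLaw.Theses.HoelderEscapeProfile.CornerNoDip := by
  intro h ω₂ lam β γ hω hl hβ T hT μ hGibbs hShiftI hRev D hPres hCov G hG Gh hGh hAbs hInt a ha ε hε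
  obtain ⟨hstat, hdyn⟩ := stub_profileRepresentation ω₂ lam β γ hω hl hβ T hT μ hGibbs hShiftI hRev D hPres hCov
    _ rfl _ rfl _ rfl G hG Gh hGh hAbs hInt
  exact corner_noDip_of_profile_of_negMoment _ _ Gh ha hε hdyn hstat
    (stub_profileSupBound ω₂ lam β γ hω hl hβ T hT μ hGibbs hShiftI hRev D hPres hCov _ rfl _ rfl _ rfl)
    (h ω₂ lam β γ hω hl hβ T hT μ hGibbs hShiftI hRev D hPres hCov _ rfl _ rfl _ rfl)

/-- **GLUE (two children): `MesoNegativePartNegligible → FarNegativePartTight → CornerNoDip`.** Same frame;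
first hypothesis: for some `0 < θ < 1/3` and every `L, ε > 0`, eventually in `ν`,
`ν · Σ_{ν^{-θ} < |x|, |x|√ν ≤ L} x²·S̄_ν(x)⁻ ≤ ε` (near-positivity of the Abel heating profile on the diffusive
window); second: for every `ε > 0` there are `L, ν₀ > 0` with `ν · Σ_{L < |x|√ν} x²·S̄_ν(x)⁻ ≤ ε` for `ν ≤ ν₀`
(no negative heating mass beyond the diffusive scale) — the registered stubs of line `heatprofile` in cycles 1–2,
verbatim. Via `corner_noDip_of_profile` with the landed stubs 1–2 discharged. Glue only: closes nothing. [folklore] -/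
theorem cornerNoDip_of_meso_of_far :
    (∀ ω₂ lam β γ : ℝ, 0 < ω₂ → 0 < lam → 0 < β → ∀ T : ℝ, 0 < T →
      ∀ μ : Measure ChainConfig, (pinnedChain ω₂ lam β γ).IsChainGibbsMeasure T μ → IsShiftInvariant μ →
      μ.map (fun σ : ChainConfig => fun x : ℤ => ((σ x).1, -(σ x).2)) = μ →
      ∀ D : InfiniteChainDynamics (pinnedChain ω₂ lam β γ), D.PreservesMeasure μ →
      (∀ t : ℝ, ∀ᵐ σ ∂μ, D.flow t (shift σ) = shift (D.flow t σ)) →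
      ∀ h : ChainConfig → ℤ → ℝ, h = (fun (σ : ChainConfig) (x : ℤ) =>
      (σ x).2 ^ 2 / 2 + (pinnedChain ω₂ lam β γ).U (σ x).1 +
      ((pinnedChain ω₂ lam β γ).V ((σ (x + 1)).1 - (σ x).1) +
      (pinnedChain ω₂ lam β γ).V ((σ x).1 - (σ (x - 1)).1)) / 2) →
      ∀ S : ℤ → ℝ → ℝ, S = (fun (x : ℤ) (t : ℝ) =>
      ∫ σ, (h σ 0 - ∫ σ', h σ' 0 ∂μ) * (h (D.flow t σ) x - ∫ σ', h σ' 0 ∂μ) ∂μ) →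
      ∀ Sb : ℝ → ℤ → ℝ, Sb = (fun (ν : ℝ) (x : ℤ) =>
      ν * ∫ t in Set.Ioi (0:ℝ), Real.exp (-(ν * t)) * S x t) →
      ∃ θ : ℝ, 0 < θ ∧ θ < 1 / 3 ∧ ∀ L : ℝ, 0 < L → ∀ ε : ℝ, 0 < ε →
      ∃ ν₀ : ℝ, 0 < ν₀ ∧ ∀ ν : ℝ, 0 < ν → ν ≤ ν₀ →
      ν * (∑' x : ℤ, (if ν ^ (-θ) < |(x : ℝ)| ∧ |(x : ℝ)| * Real.sqrt ν ≤ L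
      then (x : ℝ) ^ 2 * max (-(Sb ν x)) 0 else 0)) ≤ ε) →
    (∀ ω₂ lam β γ : ℝ, 0 < ω₂ → 0 < lam → 0 < β → ∀ T : ℝ, 0 < T →
      ∀ μ : Measure ChainConfig, (pinnedChain ω₂ lam β γ).IsChainGibbsMeasure T μ → IsShiftInvariant μ →
      μ.map (fun σ : ChainConfig => fun x : ℤ => ((σ x).1, -(σ x).2)) = μ →
      ∀ D : InfiniteChainDynamics (pinnedChain ω₂ lam β γ), D.PreservesMeasure μ →
      (∀ t : ℝ, ∀ᵐ σ ∂μ, D.flow t (shift σ) = shift (D.flow t σ)) →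
      ∀ h : ChainConfig → ℤ → ℝ, h = (fun (σ : ChainConfig) (x : ℤ) =>
      (σ x).2 ^ 2 / 2 + (pinnedChain ω₂ lam β γ).U (σ x).1 +
      ((pinnedChain ω₂ lam β γ).V ((σ (x + 1)).1 - (σ x).1) +
      (pinnedChain ω₂ lam β γ).V ((σ x).1 - (σ (x - 1)).1)) / 2) →
      ∀ S : ℤ → ℝ → ℝ, S = (fun (x : ℤ) (t : ℝ) =>
      ∫ σ, (h σ 0 - ∫ σ', h σ' 0 ∂μ) * (h (D.flow t σ) x - ∫ σ', h σ' 0 ∂μ) ∂μ) →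
      ∀ Sb : ℝ → ℤ → ℝ, Sb = (fun (ν : ℝ) (x : ℤ) =>
      ν * ∫ t in Set.Ioi (0:ℝ), Real.exp (-(ν * t)) * S x t) →
      ∀ ε : ℝ, 0 < ε → ∃ L : ℝ, 0 < L ∧ ∃ ν₀ : ℝ, 0 < ν₀ ∧
      ∀ ν : ℝ, 0 < ν → ν ≤ ν₀ →
      ν * (∑' x : ℤ, (if L < |(x : ℝ)| * Real.sqrt ν
      then (x : ℝ) ^ 2 * max (-(Sb ν x)) 0 else 0)) ≤ ε) →
    Summit.AtomisticToContinuum.FouriersLaw.Theses.HoelderEscapeProfile.CornerNoDip := by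
  intro h3 h4 ω₂ lam β γ hω hl hβ T hT μ hGibbs hShiftI hRev D hPres hCov G hG Gh hGh hAbs hInt a ha ε hε
  obtain ⟨hstat, hdyn⟩ := stub_profileRepresentation ω₂ lam β γ hω hl hβ T hT μ hGibbs hShiftI hRev D hPres hCov
    _ rfl _ rfl _ rfl G hG Gh hGh hAbs hInt
  exact corner_noDip_of_profile _ _ Gh a ε ha hε hdyn hstat
    (stub_profileSupBound ω₂ lam β γ hω hl hβ T hT μ hGibbs hShiftI hRev D hPres hCov _ rfl _ rfl _ rfl)
    (h3 ω₂ lam β γ hω hl hβ T hT μ hGibbs hShiftI hRev D hPres hCov _ rfl _ rfl _ rfl)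
    (h4 ω₂ lam β γ hω hl hβ T hT μ hGibbs hShiftI hRev D hPres hCov _ rfl _ rfl _ rfl)

end Summit.AtomisticToContinuum.FouriersLaw.Theorems.CornerNoDip.HeatProfile

end
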